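import Mathlib.FieldTheory.Galois.Infinite
import Literature.AnabelianGeometry.EtaleTheta.SettingModelTate2
import Literature.AnabelianGeometry.EtaleTheta.ThetaSettingOriginClauses

/-!
# The origin profile of the root NV model: which clauses of `IsThm16Origin` / `IsTateOrigin` hold at
# `ThetaSetting.model p`

ROW «K3 AT THE ROOT MODEL» (abc-iut-L2-lead gen 3, R44), part (a). abc-iut-L2-t6's predicate
`ThetaSetting.IsThm16Origin D` (`ThetaSettingOriginClauses.lean`) bundles the six printed origin clauses
of the [EtTh] §1 setting that Thm. 1.6 (i) consumes: R1 (`Thm16Sub.KerToZIsCompactlyGenerated`,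
«`Z` from the dual graph», p. 12), R2 (`Thm16Sub.GtpYNFromCusp`, the cusp-section construction of `Y_N`,
p. 13), the cusp of `X^log` (type `(1,1)`), R3 (the two quotient topologies, p. 12) and TM₂ (the
Tate-module clause at level `2`, p. 13); `ThetaSetting.IsTateOrigin D` is the Tate-module clause at every
level `N`. This file records, as kernel theorems, the truth value of EACH clause at abc-iut-L2-t1's root
non-vacuity model `ThetaSetting.model p` (`Π^tp_X = F₂ × G_{ℚ_p}` discrete, `K = ℚ_p`, `q_X = p²`, no
closed points):

* R2 HOLDS vacuously (`model_gtpYNFromCusp`), as does [SemiAnbd] Thm. 6.5 (iii) for the toy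
  (`model_isoPreservesCuspidalDecomp`): the model curve has no cusps
  (`not_isCuspidalDecompositionGroup_model`);
* the cusp clause FAILS (`not_exists_cuspidal_le_GtpY_model`);
* R3 HOLDS (`model_isQuotientMap_toTheta`, `model_isQuotientMap_thetaToEll`): discrete quotients;
* TM₂ HOLDS: `SettingModel.model_tate2` (`SettingModelTate2.lean`);
* R1 FAILS (`not_kerToZIsCompactlyGenerated_model`): a compact subgroup of the discrete `Π^tp_X` is
  finite, hence killed by the `b`-exponent homomorphism `Π^tp_X → ℤ`, whereas `(b, 1) ∈ Π^tp_Y` has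
  `b`-exponent `1`;
* hence `¬ (ThetaSetting.model p).IsThm16Origin` (`not_isThm16Origin_model`) — the toy is consistency
  evidence for the root and for the clauses R2/R3/TM₂ one by one, not a producer of the origin predicate
  (abc-iut-L2-t1, INBOX 2026-08-26T04:11:45Z: that needs a finer, non-split model);
* `IsTateOrigin` FAILS (`model_not_isTateOrigin`): at level `N = 3` the Kummer clause (c) cannot hold,
  because `r³ = q_X = p²` has no solution in `ℚ_p` (valuation), so some `σ ∈ G_{ℚ_p}` moves `r`
  (Galois correspondence for `ℚ̄_p/ℚ_p`), `σ r = ζ^m r` with `3 ∤ m`, while in the split product the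
  commutator of `z` with `(1, σ)` is trivial — contradicting the order-`3` clause. This certifies the
  docstring «genuine models only» of `IsTateOrigin`.

Proof-only (no definitions). Framing: consistency evidence about a toy model; typed ≠ proved for the
paper's objects; no side is taken on [IUTchIII] Cor. 3.12.
-/

namespace Literature.AnabelianGeometry.EtaleTheta.SettingModel

open Literature.AnabelianGeometry.SemiGraphs Thm16Sub Topology

variable (p : ℕ) [Fact p.Prime]

/-! ### The cusp clauses: no cusps at the toy -/

/-- The model curve has no closed points (`Pt := PEmpty`), so no subgroup of `Π^tp_X` is a cuspidal
decomposition group. [cite: MochizukiEtTh2009, §1 p.12] -/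
theorem not_isCuspidalDecompositionGroup_model (Dc : Subgroup (PiTp p)) :
    ¬ (ThetaSetting.model p).IsCuspidalDecompositionGroup Dc := by
  rintro ⟨x, -, -⟩
  exact PEmpty.elim x

/-- Likewise no subgroup is a cuspidal GEOMETRIC decomposition group. [cite: MochizukiEtTh2009, §1 p.12] -/
theorem not_isCuspidalGeometricDecompositionGroup_model (I : Subgroup (PiTp p)) :
    ¬ (ThetaSetting.model p).IsCuspidalGeometricDecompositionGroup I := by
  rintro ⟨x, -, -⟩
  exact PEmpty.elim x

/-- **R2 holds at the toy, vacuously**: the cusp-section characterisation of `Π^tp_{Y_N}`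
(`Thm16Sub.GtpYNFromCusp`, p. 13) quantifies over cuspidal decomposition groups inside `Π^tp_Y`, of
which the model has none. [cite: MochizukiEtTh2009, §1 p.13] -/
theorem model_gtpYNFromCusp (N : ℕ+) : GtpYNFromCusp (ThetaSetting.model p) N :=
  fun Dc hDc _ => (not_isCuspidalDecompositionGroup_model p Dc hDc).elim

/-- **The cusp clause of `IsThm16Origin` fails at the toy**: there is no cuspidal decomposition group at
all, let alone one inside `Π^tp_Y` («`X^log` of type `(1,1)`» is NOT modelled). [cite: MochizukiEtTh2009, §1 p.12] -/
theorem not_exists_cuspidal_le_GtpY_model :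
    ¬ ∃ Dc : Subgroup (ThetaSetting.model p).PiTemp,
      (ThetaSetting.model p).IsCuspidalDecompositionGroup Dc ∧ Dc ≤ (ThetaSetting.model p).GtpY := by
  rintro ⟨Dc, hDc, -⟩
  exact not_isCuspidalDecompositionGroup_model p Dc hDc

/-- [SemiAnbd] Thm. 6.5 (iii) («isomorphisms preserve cuspidal decomposition groups») holds VACUOUSLY
for self-isomorphisms of the toy. [cite: MochizukiEtTh2009, Thm 1.6 (i) p.24] -/
theorem model_isoPreservesCuspidalDecomp :
    (ThetaSetting.model p).IsoPreservesCuspidalDecomp (ThetaSetting.model p).toTemperedCurve :=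
  fun _ D =>
    ⟨fun h => (not_isCuspidalDecompositionGroup_model p D h).elim,
      fun h => (not_isCuspidalGeometricDecompositionGroup_model p D h).elim⟩

/-! ### R3: the quotient topologies (discrete) -/

/-- A surjection between discrete spaces is a quotient map. [folklore] -/
private theorem isQuotientMap_of_discrete {X Y : Type*} [tX : TopologicalSpace X] [DiscreteTopology X]
    [tY : TopologicalSpace Y] [DiscreteTopology Y] {f : X → Y} (hf : Function.Surjective f) :
    Topology.IsQuotientMap f where
  eq_coinduced := by
    rw [DiscreteTopology.eq_bot (α := Y), DiscreteTopology.eq_bot (α := X), coinduced_bot]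
  surjective := hf

/-- **R3 (first quotient) holds at the toy**: `Π^tp_X ↠ (Π^tp_X)^Θ` is a quotient map (both discrete).
[cite: MochizukiEtTh2009, §1 p.12] -/
theorem model_isQuotientMap_toTheta : Topology.IsQuotientMap (ThetaSetting.model p).toTheta := by
  haveI : DiscreteTopology (GTheta p) := QuotientGroup.discreteTopology (isOpen_discrete _)
  exact isQuotientMap_of_discrete (ThetaSetting.model p).toTheta_surjective

/-- **R3 (second quotient) holds at the toy**: `(Π^tp_X)^Θ ↠ (Π^tp_X)^ell` is a quotient map (both
discrete). [cite: MochizukiEtTh2009, §1 p.12] -/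
theorem model_isQuotientMap_thetaToEll :
    Topology.IsQuotientMap (ThetaSetting.model p).thetaToEll := by
  haveI : DiscreteTopology (GTheta p) := QuotientGroup.discreteTopology (isOpen_discrete _)
  haveI : DiscreteTopology (GEll p) := QuotientGroup.discreteTopology (isOpen_discrete _)
  exact isQuotientMap_of_discrete (ThetaSetting.model p).thetaToEll_surjective

/-! ### R1 fails: compact subgroups of the discrete `Π^tp_X` are invisible to `Z` -/

/-- In a topological group, a continuous homomorphism to the discrete group `ℤ` kills every compact
subgroup (its image is a finite subgroup of `ℤ`). [folklore] -/
private theorem le_ker_of_isCompact {G : Type*} [Group G] [TopologicalSpace G]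
    (φ : G →* Multiplicative ℤ) (hφ : Continuous φ) (C : Subgroup G) (hC : IsCompact (C : Set G)) :
    C ≤ φ.ker := by
  intro g hg
  rw [MonoidHom.mem_ker]
  by_contra hne
  have hfin : (φ '' (C : Set G)).Finite := (hC.image hφ).finite_of_discrete
  have hm : Multiplicative.toAdd (φ g) ≠ 0 := by
    intro h0; exact hne (by rw [← ofAdd_toAdd (φ g), h0, ofAdd_zero])
  -- `n ↦ φ (g ^ n)` is injective with values in `φ '' C`
  have hinj : Function.Injective fun n : ℕ => φ (g ^ n) := by
    intro n₁ n₂ h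
    simp only [map_pow] at h
    have h' := congrArg Multiplicative.toAdd h
    rw [toAdd_pow, toAdd_pow, nsmul_eq_mul, nsmul_eq_mul] at h'
    exact_mod_cast mul_right_cancel₀ hm h'
  exact hfin.not_infinite
    (Set.infinite_of_injective_forall_mem hinj fun n => ⟨g ^ n, C.pow_mem hg n, rfl⟩)

/-- **R1 fails at the toy**: `Π^tp_Y = Ker(Π^tp_X ↠ Z)` is NOT the closed subgroup topologically
generated by the compact subgroups of `Π^tp_X`. In the discrete `Π^tp_X = F₂ × G_{ℚ_p}` every compact
subgroup is finite, hence contained in the kernel of the `b`-exponent homomorphism `Π^tp_X → ℤ`; so is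
the closure they generate, while `(b, 1) ∈ Π^tp_Y` has `b`-exponent `1`. (abc-iut-L2-t1 stated this
informally, INBOX 2026-08-26T04:11:45Z; here WITHOUT the torsion-freeness of `G_{ℚ_p}`.) The printed R1 is a
statement about the genuine `Z` of the dual graph ([SemiAnbd] Thm. 3.7 (iv)), which the toy does not
model. [cite: MochizukiEtTh2009, §1 p.12] -/
theorem not_kerToZIsCompactlyGenerated_model :
    ¬ KerToZIsCompactlyGenerated (ThetaSetting.model p) := by
  intro h
  -- the `b`-exponent homomorphism
  let φ : PiTp p →* Multiplicative ℤ :=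
    (Heis.yHom.comp heisHom).comp (Del.val.comp (MonoidHom.fst Del (Gam p)))
  have hφ : ∀ g : PiTp p, φ g = Multiplicative.ofAdd (heisHom (Del.val g.1)).y := fun _ => rfl
  have hle : (Subgroup.closure {g : PiTp p | ∃ C : Subgroup (PiTp p),
      IsCompact (C : Set (PiTp p)) ∧ g ∈ C}).topologicalClosure ≤ φ.ker := by
    refine Subgroup.topologicalClosure_minimal _ ?_ (isClosed_discrete _)
    rw [Subgroup.closure_le]
    rintro g ⟨C, hC, hgC⟩
    exact le_ker_of_isCompact φ continuous_of_discreteTopology C hC hgC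
  -- `(b, 1) ∈ Π^tp_Y` has `b`-exponent `1`
  obtain ⟨db, hdb⟩ := Del.val_bijective.2 (FreeGroup.of 1)
  have hy : ((db, 1) : PiTp p) ∈ (ThetaSetting.model p).GtpY := by
    change ((db, 1) : PiTp p) ∈ (toZM p).ker
    rw [MonoidHom.mem_ker, toZM_apply]
    change Multiplicative.ofAdd (heisHom (Del.val db)).x = 1
    rw [hdb]; simp
  have hker : ((db, 1) : PiTp p) ∈ φ.ker := hle (h ▸ hy)
  rw [MonoidHom.mem_ker, hφ] at hker
  change Multiplicative.ofAdd (heisHom (Del.val db)).y = 1 at hker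
  rw [hdb, heisHom_of_one] at hker
  exact one_ne_zero (ofAdd_eq_one.mp hker)

/-- **The toy is NOT an origin setting**: `IsThm16Origin` fails at `ThetaSetting.model p` (already at R1;
independently at the cusp clause, `not_exists_cuspidal_le_GtpY_model`). The remaining clauses R2, R3, TM₂
hold there (`model_gtpYNFromCusp`, `model_isQuotientMap_toTheta`, `model_isQuotientMap_thetaToEll`,
`SettingModel.model_tate2`). [cite: MochizukiEtTh2009, §1 p.12] -/
theorem not_isThm16Origin_model : ¬ (ThetaSetting.model p).IsThm16Origin :=
  fun h => not_kerToZIsCompactlyGenerated_model p h.kerToZ_compactlyGenerated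

/-- The clauses of `IsThm16Origin` that DO hold at the toy, bundled: R2 (every `N`), R3 (both quotients),
TM₂. [cite: MochizukiEtTh2009, §1 p.13] -/
theorem model_origin_clauses :
    (∀ N : ℕ+, GtpYNFromCusp (ThetaSetting.model p) N) ∧
      Topology.IsQuotientMap (ThetaSetting.model p).toTheta ∧
      Topology.IsQuotientMap (ThetaSetting.model p).thetaToEll ∧
      GKNIsKernelOfAction (ThetaSetting.model p) 2 :=
  ⟨model_gtpYNFromCusp p, model_isQuotientMap_toTheta p, model_isQuotientMap_thetaToEll p,
    model_gknIsKernelOfAction_two p⟩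

/-! ### `IsTateOrigin` fails: the Kummer clause at level `3` -/

/-- `p² ∈ ℚ_p` is not a cube: `3 · v(x) = 2` has no solution. [cite: Gouvea1993PadicNumbers, Prop 6.3.11] -/
private theorem padic_pow_three_ne_sq (x : ℚ_[p]) : x ^ 3 ≠ (p : ℚ_[p]) ^ 2 := by
  intro h
  have hp : (p : ℚ_[p]) ≠ 0 := Nat.cast_ne_zero.mpr (Fact.out : p.Prime).ne_zero
  have hx : x ≠ 0 := by
    rintro rfl
    rw [zero_pow three_ne_zero] at h
    exact pow_ne_zero 2 hp h.symm
  have hv := congrArg Padic.valuation h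
  rw [Padic.valuation_pow, Padic.valuation_pow, Padic.valuation_p] at hv
  omega

/-- A cube root of `p²` in `ℚ̄_p` is moved by some `σ ∈ G_{ℚ_p}` (it is not in `ℚ_p`, and `ℚ_p` is the
fixed field of `G_{ℚ_p}`). [cite: MilneFT2022, Thm 7.13] -/
private theorem exists_algEquiv_apply_ne {r : PadicAlgCl p} (hr : r ^ 3 = ((p : ℕ) : PadicAlgCl p) ^ 2) :
    ∃ σ : GQp p, σ r ≠ r := by
  by_contra hall
  haveI : IsGalois ℚ_[p] (PadicAlgCl p) := {}
  have hmem : r ∈ IntermediateField.fixedField (⊤ : Subgroup (GQp p)) := by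
    rw [IntermediateField.mem_fixedField_iff]
    intro σ _
    by_contra hne
    exact hall ⟨σ, hne⟩
  rw [← IntermediateField.fixingSubgroup_bot, InfiniteGalois.fixedField_fixingSubgroup,
    IntermediateField.mem_bot] at hmem
  obtain ⟨x, hx⟩ := hmem
  refine padic_pow_three_ne_sq p x ((algebraMap ℚ_[p] (PadicAlgCl p)).injective ?_)
  rw [map_pow, map_pow, hx, hr, map_natCast]

/-- **`IsTateOrigin` fails at the toy** (the print-faithful Tate-module clause for EVERY `N` is for
GENUINE models only, as its docstring says). At `N = 3`: `r³ = q_X = p²` forces `r ∉ ℚ_p`, so some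
`σ ∈ G_{ℚ_p} = G_K` has `σ r = ζ^m · r` with `0 < m < 3`; for `g := (1, σ) ∈ Π^tp_X = F₂ × G_{ℚ_p}` the
commutator with `z ∈ Δ^tp_X = F₂ × 1` is trivial, so the Kummer clause (c) puts `(ȳ₁)^m` into
`3·(Δ^tp_Y)^ell`, contradicting the order clause (a′) (`3 ∣ m`). [cite: MochizukiEtTh2009, §1 p.13] -/
theorem model_not_isTateOrigin : ¬ (ThetaSetting.model p).IsTateOrigin := by
  intro h
  obtain ⟨y₁, z, ζ, r, -, hz, -, hζ, hr, -, hord, -, hkum⟩ := h.tate 3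
  have h3 : ((3 : ℕ+) : ℕ) = 3 := rfl
  rw [h3] at hζ hr
  have hp0 : ((p : ℕ) : PadicAlgCl p) ≠ 0 := Nat.cast_ne_zero.mpr (Fact.out : p.Prime).ne_zero
  have hr' : r ^ 3 = ((p : ℕ) : PadicAlgCl p) ^ 2 := hr
  have hr0 : r ≠ 0 := by
    rintro rfl
    rw [zero_pow three_ne_zero] at hr'
    exact pow_ne_zero 2 hp0 hr'.symm
  obtain ⟨σ, hσ⟩ := exists_algEquiv_apply_ne p hr'
  -- `σ r / r` is a cube root of unity, hence a power of the primitive `ζ`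
  have hroot : (σ r / r) ^ 3 = 1 := by
    rw [div_pow, ← map_pow, hr', map_pow, map_natCast, div_self (pow_ne_zero 2 hp0)]
  obtain ⟨m, hm3, hm⟩ := hζ.eq_pow_of_pow_eq_one hroot
  have hσr : σ r = ζ ^ m * r := by rw [hm, div_mul_cancel₀ _ hr0]
  -- apply the Kummer clause to `g := (1, σ)`
  let g : (ThetaSetting.model p).PiTemp := ((1 : Del), (σ : Gam p))
  have haug : (ThetaSetting.model p).aug g r = ζ ^ m * r := hσr
  have hz2 : z.2 = 1 := (mem_deltaTemp_iff p z).mp hz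
  have hc : toEll (ThetaSetting.model p) (g * z * g⁻¹ * z⁻¹) = 1 := by
    rw [toEll_model_apply]; exact mk_KEll_commutator_eq_one p hz2 g
  have hk := hkum g m haug
  rw [hc, one_mul, inv_mem_iff, hord m, h3] at hk
  -- `3 ∣ m < 3` forces `m = 0`, i.e. `σ r = r`
  have hm0 : m = 0 := Nat.eq_zero_of_dvd_of_lt hk hm3
  exact hσ (by rw [hσr, hm0, pow_zero, one_mul])

/-- **Corollary: root + guard do not give the origin clauses.** `∃ D, D.IsEtThOrigin ∧ ¬ D.IsThm16Origin ∧
¬ D.IsTateOrigin` — witnessed by the toy. [cite: MochizukiEtTh2009, §1 p.12] -/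
theorem exists_isEtThOrigin_not_isThm16Origin :
    ∃ D : ThetaSetting p, D.IsEtThOrigin ∧ ¬ D.IsThm16Origin ∧ ¬ D.IsTateOrigin :=
  ⟨ThetaSetting.model p, ThetaSetting.model_isEtThOrigin p, not_isThm16Origin_model p,
    model_not_isTateOrigin p⟩

end Literature.AnabelianGeometry.EtaleTheta.SettingModel
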